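import Literature.NumberTheory.LFunctions.GaussianHeckeClassTwo
import Literature.NumberTheory.LFunctions.GaussianHeckeClassOneMollified
import Literature.NumberTheory.LFunctions.GaussianHeckeRepresentatives
import Literature.NumberTheory.LFunctions.GaussianHeckeMeanValueLargeSieveProofs
import HarnessLib

/-!
# Ricci's zero-density theorem for `L(s, λ^m)`, `m ≤ K`, from a Weyl-type bound on `Re s = 1/2`

Topic `Literature/NumberTheory/LFunctions`.  Everything in this file is PROVED; no definitions, no named
facts.  This is the assembly of the zero-detection method (Ingham 1937/1940 for `ζ`; Montgomery 1971,
Ch. 12) for the family of Hecke `L`-functions `D_m = 4 L(·, λ^m)` of `ℚ(i)`: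

* `GaussianHecke.exists_family` — representatives: a finite family `Z` of pairs `(m, ρ)`, `1 ≤ m ≤ K`,
  `D_m(ρ) = 0`, `Re ρ ≥ σ`, `|Im ρ| < T`, ordinates `≥ 1` apart for each `m`, with
  `N(σ; T, K) ≤ 2A log(T + 2K + 8) · #Z` (`GaussianHecke.exists_wellSpaced_representatives`).
* `GaussianHecke.zeroCount_le_of_pointwise` — **the density theorem from a pointwise bound**: if
  `|D_m(1/2 + iτ)| ≤ A₁ (m + |τ| + 2)^θ log^c(m + |τ| + 2)` for all `m ≥ 1` and real `τ` (`0 ≤ θ < 1`), then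
  for `K ≥ 2`, `2 ≤ T ≤ K`, `7/10 ≤ σ ≤ 1`,
  `N(σ; T, K) ≤ C · T · K^{(2+4θ)(1-σ)} (log K)^{2c+268}`:
  every zero of the family is of class I or II (`GaussianHecke.zero_detect`, `X = K`, `x = 8K^{1+2θ}`),
  the class-I zeros are counted by `GaussianHecke.exists_classOne_mollified`
  (`≪ T x^{2-2σ} logs = T K^{(2+4θ)(1-σ)} logs`) and the class-II zeros by
  `GaussianHecke.exists_classTwo` (`≪ x^{1-2σ} K^{2θ} · K T logs = T K^{(2+4θ)(1-σ)} logs`); the mean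
  value theorem for Hecke polynomials is `GaussianInt.JarviniemiTeravainen2024_heckeMVT_holds`.
* `GaussianHecke.ricci_zeroDensity_of_pointwise` — with `θ = 1/3` (a Weyl-type bound, Kaufman 1979 for
  the Gaussian field) this is exactly `(10/3)(1-σ)`: together with the trivial range `σ ≤ 7/10`
  (`ricci_bound_of_le_seven_tenths`) and `ricci_reduction`, **`ricci_zeroDensity` follows from the
  Weyl-type bound on the critical line**.  The tree has no subconvexity bound for `D_m` yet, so the named
  fact `ricci_zeroDensity` itself stays undischarged; this theorem isolates exactly what is missing.

## References

* H. L. Montgomery, *Topics in Multiplicative Number Theory*, LNM 227 (1971), Ch. 12. [Montgomery1971]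
* B. Huang, J. Liu, Z. Rudnick, *Gaussian primes in almost all narrow sectors*, Acta Arith. 193 (2020),
  Thm. 3 (quoting S. Ricci, *Local distribution of primes*, PhD thesis, Michigan 1976). [HuangLiuRudnick2020]
* R. M. Kaufman, *An estimate of the Hecke `L`-functions of the Gaussian field on the line `Re s = 1/2`*,
  Zap. Nauchn. Sem. LOMI 91 (1979) (the expected source of the `θ = 1/3` input; not used here).
-/

noncomputable section

open Finset Complex Real Filter Topology

namespace Literature.NumberTheory.LFunctions

namespace GaussianHecke

open GaussianInt GaussianTheta

open scoped Classical

/-! ### The family of representatives -/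

/-- **Representatives for the whole family** (see the module docstring). [cite: Montgomery1971, Ch. 12] -/
theorem exists_family : ∃ A : ℝ, 0 < A ∧ ∀ (K : ℕ) (σ T : ℝ), 1 / 2 ≤ σ → 0 ≤ T →
    ∃ Z : Finset (ℕ × ℂ), (∀ p ∈ Z, (1 ≤ p.1 ∧ p.1 ≤ K) ∧ heckeL p.1 p.2 = 0 ∧ σ ≤ p.2.re ∧ |p.2.im| < T) ∧
      (∀ p ∈ Z, ∀ p' ∈ Z, p.1 = p'.1 → p ≠ p' → 1 ≤ |p.2.im - p'.2.im|) ∧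
      (zeroCount σ T K : ℝ) ≤ 2 * A * Real.log (T + 2 * K + 8) * Z.card := by
  obtain ⟨A, hA, hrep⟩ := exists_wellSpaced_representatives
  refine ⟨A, hA, fun K σ T hσ hT ↦ ?_⟩
  have hrep' : ∀ m : ℕ, ∃ Z : Finset ℂ, m ≠ 0 →
      ((∀ ρ ∈ Z, heckeL m ρ = 0 ∧ σ ≤ ρ.re ∧ |ρ.im| < T) ∧
        (∀ ρ ∈ Z, ∀ ρ' ∈ Z, ρ ≠ ρ' → 1 ≤ |ρ.im - ρ'.im|) ∧
        (zeroCountIn m σ T : ℝ) ≤ 2 * A * Real.log (T + 2 * m + 8) * Z.card) := by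
    intro m
    by_cases hm : m = 0
    · exact ⟨∅, fun h ↦ (h hm).elim⟩
    · obtain ⟨Z, hZ⟩ := hrep m hm σ T hσ hT
      exact ⟨Z, fun _ ↦ hZ⟩
  choose Zm hZm using hrep'
  set ZF : Finset (ℕ × ℂ) := (Icc 1 K).biUnion (fun m ↦ (Zm m).image (fun ρ ↦ (m, ρ))) with hZF
  have hmem : ∀ p ∈ ZF, p.1 ∈ Icc 1 K ∧ p.2 ∈ Zm p.1 := by
    intro p hp
    simp only [hZF, mem_biUnion, mem_image] at hp
    obtain ⟨m, hm, ρ, hρ, rfl⟩ := hp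
    exact ⟨hm, hρ⟩
  have hdisj : (↑(Icc 1 K) : Set ℕ).PairwiseDisjoint (fun m ↦ (Zm m).image (fun ρ ↦ (m, ρ))) := by
    intro m _ m' _ hne
    simp only [Function.onFun]
    rw [disjoint_left]
    intro p hp hp'
    rw [mem_image] at hp hp'
    obtain ⟨ρ, _, rfl⟩ := hp
    obtain ⟨ρ', _, h⟩ := hp'
    exact hne (congrArg Prod.fst h).symm
  have hcard : ZF.card = ∑ m ∈ Icc 1 K, (Zm m).card := by
    rw [hZF, card_biUnion hdisj]
    exact sum_congr rfl fun m _ ↦ card_image_of_injective _ (fun ρ ρ' h ↦ by simpa using h)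
  refine ⟨ZF, fun p hp ↦ ?_, fun p hp p' hp' h1 hne ↦ ?_, ?_⟩
  · obtain ⟨hm, hρ⟩ := hmem p hp
    have hm' := mem_Icc.1 hm
    have hm0 : p.1 ≠ 0 := by omega
    exact ⟨hm', (hZm p.1 hm0).1 p.2 hρ⟩
  · obtain ⟨hm, hρ⟩ := hmem p hp
    obtain ⟨-, hρ'⟩ := hmem p' hp'
    have hm0 : p.1 ≠ 0 := by have := mem_Icc.1 hm; omega
    rw [← h1] at hρ'
    have hne' : p.2 ≠ p'.2 := fun h ↦ hne (Prod.ext h1 h)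
    exact (hZm p.1 hm0).2.1 p.2 hρ p'.2 hρ' hne'
  · rw [zeroCount, Nat.cast_sum, hcard, Nat.cast_sum, mul_sum]
    refine sum_le_sum fun m hm ↦ ?_
    have hm' := mem_Icc.1 hm
    have hm0 : m ≠ 0 := by omega
    have hmK : (m : ℝ) ≤ K := by exact_mod_cast hm'.2
    have hm1 : (0 : ℝ) ≤ m := Nat.cast_nonneg m
    refine ((hZm m hm0).2.2).trans ?_
    have hlog : Real.log (T + 2 * m + 8) ≤ Real.log (T + 2 * K + 8) :=
      Real.log_le_log (by linarith) (by linarith)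
    exact mul_le_mul_of_nonneg_right (mul_le_mul_of_nonneg_left hlog (by linarith)) (Nat.cast_nonneg _)

/-! ### Elementary bookkeeping in `ℓ = log K` -/

/-- `ℓ^a ≤ 2^b ℓ^b` for `a ≤ b` when `2ℓ ≥ 1`, `ℓ ≥ 0`. [folklore] -/
theorem pow_le_two_pow_mul_pow {ℓ : ℝ} (hℓ : 1 ≤ 2 * ℓ) (hℓ0 : 0 ≤ ℓ) {a b : ℕ} (hab : a ≤ b) :
    ℓ ^ a ≤ 2 ^ b * ℓ ^ b := by
  obtain ⟨d, rfl⟩ := Nat.exists_eq_add_of_le hab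
  have h1 : (1 : ℝ) ≤ (2 * ℓ) ^ d := one_le_pow₀ hℓ
  have h2 : (2 : ℝ) ^ d ≤ 2 ^ (a + d) := pow_le_pow_right₀ (by norm_num) (by omega)
  calc ℓ ^ a = ℓ ^ a * 1 := (mul_one _).symm
    _ ≤ ℓ ^ a * (2 * ℓ) ^ d := mul_le_mul_of_nonneg_left h1 (pow_nonneg hℓ0 a)
    _ = 2 ^ d * ℓ ^ (a + d) := by rw [mul_pow, pow_add]; ring
    _ ≤ 2 ^ (a + d) * ℓ ^ (a + d) := mul_le_mul_of_nonneg_right h2 (pow_nonneg hℓ0 _)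

/-- For `K ≥ 2`: `log 2 ≤ log K`, `1 ≤ 2 log K`. [folklore] -/
theorem one_le_two_mul_log {K : ℕ} (hK : 2 ≤ K) : Real.log 2 ≤ Real.log K ∧ 1 ≤ 2 * Real.log K := by
  have hK2 : (2 : ℝ) ≤ K := by exact_mod_cast hK
  have h1 : Real.log 2 ≤ Real.log K := Real.log_le_log two_pos hK2
  exact ⟨h1, by linarith [Real.log_two_gt_d9]⟩

/-! ### The density theorem from a pointwise bound -/

/-- **Zero density for the family from a pointwise bound on the critical line** (see the module
docstring): `N(σ; T, K) ≤ C T K^{(2+4θ)(1-σ)} (log K)^{2c+268}` for `K ≥ 2`, `2 ≤ T ≤ K`,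
`7/10 ≤ σ ≤ 1`. [cite: Montgomery1971, Ch. 12, Thm 12.1 (method)] -/
theorem zeroCount_le_of_pointwise {A₁ θ : ℝ} {c : ℕ} (hA₁ : 1 ≤ A₁) (hθ : 0 ≤ θ) (hθ1 : θ < 1)
    (hPW : ∀ m : ℕ, m ≠ 0 → ∀ τ : ℝ, ‖heckeL m (1 / 2 + τ * I)‖ ≤
        A₁ * ((m : ℝ) + |τ| + 2) ^ θ * Real.log ((m : ℝ) + |τ| + 2) ^ c) :
    ∃ C : ℝ, ∀ (K : ℕ) (T σ : ℝ), 2 ≤ K → 2 ≤ T → T ≤ K → 7 / 10 ≤ σ → σ ≤ 1 →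
      (zeroCount σ T K : ℝ) ≤ C * T * (K : ℝ) ^ ((2 + 4 * θ) * (1 - σ)) * Real.log K ^ (2 * c + 268) := by
  obtain ⟨A, hA, hfam⟩ := exists_family
  obtain ⟨C₁, hC₁, hI⟩ := exists_classOne_mollified JarviniemiTeravainen2024_heckeMVT_holds
  obtain ⟨C₂, hC₂, hII⟩ := exists_classTwo JarviniemiTeravainen2024_heckeMVT_holds
  -- large literal powers and the constants are kept atomic
  obtain ⟨E8, hE8⟩ : ∃ E : ℝ, (8 : ℝ) ^ 263 = E := ⟨_, rfl⟩
  obtain ⟨E2, hE2⟩ : ∃ E : ℝ, (2 : ℝ) ^ (2 * c + 268) = E := ⟨_, rfl⟩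
  have hE80 : 0 ≤ E8 := by rw [← hE8]; exact pow_nonneg (by norm_num) 263
  have hE20 : 0 ≤ E2 := by rw [← hE2]; exact pow_nonneg (by norm_num) _
  have hδ0 : 0 < (1 - θ) / 2 := by linarith
  have hA'0 : 0 ≤ A₁ * (1 + c / ((1 - θ) / 2)) ^ c :=
    mul_nonneg (by linarith) (pow_nonneg (by have := div_nonneg (Nat.cast_nonneg c) hδ0.le; linarith) c)
  obtain ⟨cI, hcI⟩ : ∃ e : ℝ, e = C₁ * 64 * E8 := ⟨_, rfl⟩
  obtain ⟨cII, hcII⟩ : ∃ e : ℝ, e = C₂ * (A₁ * (1 + c / ((1 - θ) / 2)) ^ c) ^ 2 * 9 *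
    (5 : ℝ) ^ (2 * c) * 2 * 27 := ⟨_, rfl⟩
  have hcI0 : 0 ≤ cI := by rw [hcI]; exact mul_nonneg (mul_nonneg hC₁ (by norm_num)) hE80
  have hcII0 : 0 ≤ cII := by
    rw [hcII]
    exact mul_nonneg (mul_nonneg (mul_nonneg (mul_nonneg (mul_nonneg hC₂ (sq_nonneg _)) (by norm_num))
      (pow_nonneg (by norm_num) _)) (by norm_num)) (by norm_num)
  refine ⟨8 * A * E2 * (cI + cII), ?_⟩
  intro K T σ hK hT hTK hσ hσ1
  -- parameters
  have hK2 : (2 : ℝ) ≤ K := by exact_mod_cast hK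
  have hK0 : (0 : ℝ) < K := by linarith
  have hK1 : 1 ≤ K := by omega
  obtain ⟨hℓ2, hℓ⟩ := one_le_two_mul_log hK
  obtain ⟨ℓ, hℓdef⟩ : ∃ ℓ : ℝ, ℓ = Real.log K := ⟨_, rfl⟩
  rw [← hℓdef] at hℓ2 hℓ ⊢
  have hℓ0 : 0 ≤ ℓ := by linarith
  have hlog2 : (0.6931471803 : ℝ) < Real.log 2 := Real.log_two_gt_d9
  obtain ⟨x, hx⟩ : ∃ x : ℝ, x = 8 * (K : ℝ) ^ (1 + 2 * θ) := ⟨_, rfl⟩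
  have hKp0 : 0 ≤ (K : ℝ) ^ (1 + 2 * θ) := Real.rpow_nonneg hK0.le _
  have hKpow1 : (K : ℝ) ≤ (K : ℝ) ^ (1 + 2 * θ) := by
    calc (K : ℝ) = (K : ℝ) ^ (1 : ℝ) := (Real.rpow_one _).symm
      _ ≤ (K : ℝ) ^ (1 + 2 * θ) := Real.rpow_le_rpow_of_exponent_le (by linarith) (by linarith)
  have hKx : (K : ℝ) ≤ x := by rw [hx]; linarith
  have hx8 : 8 ≤ x := by rw [hx]; linarith [hK2.trans hKpow1]
  have hx1 : 1 ≤ x := by linarith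
  have hx0 : 0 < x := by linarith
  have hT1 : 1 ≤ T := by linarith
  have hT0 : 0 ≤ T := by linarith
  have hσh : 1 / 2 ≤ σ := by linarith
  have hKe0 : 0 ≤ (K : ℝ) ^ ((2 + 4 * θ) * (1 - σ)) := Real.rpow_nonneg hK0.le _
  -- the family
  obtain ⟨Z, hZmem, hZsep, hcount⟩ := hfam K σ T hσh hT0
  -- class I / class II
  set ZI := Z.filter (fun p ↦ 1 ≤ ‖∑ n ∈ Ioc ⌊(K : ℝ)⌋₊ ⌊x⌋₊,
    detCoeff p.1 K n * (n : ℂ) ^ (-p.2) * (1 - (n : ℂ) / x) ^ 3‖) with hZI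
  set ZII := Z.filter (fun p ↦ ¬ 1 ≤ ‖∑ n ∈ Ioc ⌊(K : ℝ)⌋₊ ⌊x⌋₊,
    detCoeff p.1 K n * (n : ℂ) ^ (-p.2) * (1 - (n : ℂ) / x) ^ 3‖) with hZII
  have hsplit : Z.card = ZI.card + ZII.card := (card_filter_add_card_filter_not _).symm
  have hre1 : ∀ p ∈ Z, p.2.re ≤ 1 := fun p hp ↦ by
    obtain ⟨hm, h0, -, -⟩ := hZmem p hp
    exact (re_lt_one_of_heckeL_eq_zero (by omega) h0).le
  -- class I count
  have hIcount : (ZI.card : ℝ) ≤ C₁ * T * x ^ (2 - 2 * σ) * (1 + Real.log x) ^ 263 :=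
    hI K x σ T ZI hK1 hKx hT1 hσh hσ1 (fun p hp ↦ (hZmem p (mem_filter.1 hp).1).1)
      (fun p hp ↦ ⟨(hZmem p (mem_filter.1 hp).1).2.2.1, hre1 p (mem_filter.1 hp).1⟩)
      (fun p hp ↦ (hZmem p (mem_filter.1 hp).1).2.2.2.le)
      (fun p hp p' hp' h hne ↦ hZsep p (mem_filter.1 hp).1 p' (mem_filter.1 hp').1 h hne)
      (fun p hp ↦ (mem_filter.1 hp).2)
  -- class II count
  have hIIcount : (ZII.card : ℝ) ≤ C₂ * (A₁ * (1 + c / ((1 - θ) / 2)) ^ c) ^ 2 * x ^ (1 - 2 * σ) *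
      ((K : ℝ) + T + 2) ^ (2 * θ) * (1 + Real.log ((K : ℝ) + T + 2)) ^ (2 * c) *
      (((K : ℝ) + K) * T * (1 + Real.log K) ^ 3) := by
    refine hII A₁ θ c hA₁ hθ hθ1 hPW K x σ T K ZII (by exact_mod_cast hK1) hx1 hT1 hK1
      (fun p hp ↦ (hZmem p (mem_filter.1 hp).1).1)
      (fun p hp ↦ (hZmem p (mem_filter.1 hp).1).2.2.1)
      (fun p hp ↦ (hZmem p (mem_filter.1 hp).1).2.2.2)
      (fun p hp p' hp' h hne ↦ hZsep p (mem_filter.1 hp).1 p' (mem_filter.1 hp').1 h hne)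
      (fun p hp ↦ ?_)
    obtain ⟨hpZ, hnotI⟩ := mem_filter.1 hp
    obtain ⟨hm, h0, hβ, -⟩ := hZmem p hpZ
    have hdet := zero_detect (m := p.1) (by omega) (X := (K : ℝ)) (x := x) (by exact_mod_cast hK1) hKx hx8
      h0 (by linarith) (hre1 p hpZ)
    exact hdet.resolve_left hnotI
  -- bookkeeping: class I
  have hxpow : x ^ (2 - 2 * σ) ≤ 64 * (K : ℝ) ^ ((2 + 4 * θ) * (1 - σ)) := by
    rw [hx, Real.mul_rpow (by norm_num) hKp0, ← Real.rpow_mul hK0.le,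
      show (1 + 2 * θ) * (2 - 2 * σ) = (2 + 4 * θ) * (1 - σ) by ring]
    refine mul_le_mul_of_nonneg_right ?_ hKe0
    calc (8 : ℝ) ^ (2 - 2 * σ) ≤ (8 : ℝ) ^ (2 : ℝ) :=
          Real.rpow_le_rpow_of_exponent_le (by norm_num) (by linarith)
      _ = 64 := by norm_num
  have hlogx : 1 + Real.log x ≤ 8 * ℓ := by
    rw [hx, Real.log_mul (by norm_num) (Real.rpow_pos_of_pos hK0 _).ne', Real.log_rpow hK0, ← hℓdef]
    have h8 : Real.log 8 ≤ 3 * ℓ := by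
      rw [show (8 : ℝ) = 2 ^ 3 by norm_num, Real.log_pow]; push_cast; linarith
    have h3 : (1 + 2 * θ) * ℓ ≤ 3 * ℓ := mul_le_mul_of_nonneg_right (by linarith) hℓ0
    linarith
  have hlogx0 : 0 ≤ 1 + Real.log x := by linarith [Real.log_nonneg hx1]
  have hI' : (ZI.card : ℝ) ≤ cI * T * (K : ℝ) ^ ((2 + 4 * θ) * (1 - σ)) * ℓ ^ 263 := by
    have h1 : (1 + Real.log x) ^ 263 ≤ (8 * ℓ) ^ 263 := pow_le_pow_left₀ hlogx0 hlogx 263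
    have h1' : (8 * ℓ) ^ 263 = E8 * ℓ ^ 263 := by rw [← hE8]; exact mul_pow 8 ℓ 263
    rw [h1'] at h1
    calc (ZI.card : ℝ) ≤ C₁ * T * x ^ (2 - 2 * σ) * (1 + Real.log x) ^ 263 := hIcount
      _ ≤ C₁ * T * (64 * (K : ℝ) ^ ((2 + 4 * θ) * (1 - σ))) * (E8 * ℓ ^ 263) :=
          mul_le_mul (mul_le_mul_of_nonneg_left hxpow (mul_nonneg hC₁ hT0)) h1 (pow_nonneg hlogx0 263)
            (mul_nonneg (mul_nonneg hC₁ hT0) (mul_nonneg (by norm_num) hKe0))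
      _ = cI * T * (K : ℝ) ^ ((2 + 4 * θ) * (1 - σ)) * ℓ ^ 263 := by rw [hcI]; ring
  -- bookkeeping: class II
  have hKa0 : 0 ≤ (K : ℝ) ^ ((1 + 2 * θ) * (1 - 2 * σ)) := Real.rpow_nonneg hK0.le _
  have hK2θ0 : 0 ≤ (K : ℝ) ^ (2 * θ) := Real.rpow_nonneg hK0.le _
  have hx1pow : x ^ (1 - 2 * σ) ≤ (K : ℝ) ^ ((1 + 2 * θ) * (1 - 2 * σ)) := by
    rw [hx, Real.mul_rpow (by norm_num) hKp0, ← Real.rpow_mul hK0.le]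
    have h8 : (8 : ℝ) ^ (1 - 2 * σ) ≤ 1 := Real.rpow_le_one_of_one_le_of_nonpos (by norm_num) (by linarith)
    calc (8 : ℝ) ^ (1 - 2 * σ) * (K : ℝ) ^ ((1 + 2 * θ) * (1 - 2 * σ))
        ≤ 1 * (K : ℝ) ^ ((1 + 2 * θ) * (1 - 2 * σ)) := mul_le_mul_of_nonneg_right h8 hKa0
      _ = _ := one_mul _
  have hKT2 : (K : ℝ) + T + 2 ≤ 3 * K := by linarith
  have hKTpow : ((K : ℝ) + T + 2) ^ (2 * θ) ≤ 9 * (K : ℝ) ^ (2 * θ) := by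
    calc ((K : ℝ) + T + 2) ^ (2 * θ) ≤ (3 * (K : ℝ)) ^ (2 * θ) :=
          Real.rpow_le_rpow (by linarith) hKT2 (by linarith)
      _ = (3 : ℝ) ^ (2 * θ) * (K : ℝ) ^ (2 * θ) := Real.mul_rpow (by norm_num) hK0.le
      _ ≤ (3 : ℝ) ^ (2 : ℝ) * (K : ℝ) ^ (2 * θ) :=
          mul_le_mul_of_nonneg_right (Real.rpow_le_rpow_of_exponent_le (by norm_num) (by linarith)) hK2θ0
      _ = 9 * (K : ℝ) ^ (2 * θ) := by norm_num
  have hKTpow0 : 0 ≤ ((K : ℝ) + T + 2) ^ (2 * θ) := Real.rpow_nonneg (by linarith) _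
  have hlogKT : 1 + Real.log ((K : ℝ) + T + 2) ≤ 5 * ℓ := by
    have h1 : Real.log ((K : ℝ) + T + 2) ≤ Real.log (3 * K) := Real.log_le_log (by linarith) hKT2
    rw [Real.log_mul (by norm_num) hK0.ne', ← hℓdef] at h1
    have h3 : Real.log 3 ≤ 2 * ℓ := by
      have : Real.log 3 ≤ Real.log 4 := Real.log_le_log (by norm_num) (by norm_num)
      rw [show (4 : ℝ) = 2 ^ 2 by norm_num, Real.log_pow] at this; push_cast at this; linarith
    linarith
  have hlogKT0 : 0 ≤ 1 + Real.log ((K : ℝ) + T + 2) := by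
    have : 0 ≤ Real.log ((K : ℝ) + T + 2) := Real.log_nonneg (by linarith)
    linarith
  have hlogK3 : 1 + Real.log K ≤ 3 * ℓ := by rw [← hℓdef]; linarith
  have hlogK30 : 0 ≤ 1 + Real.log K := by rw [← hℓdef]; linarith
  have hKcomb : (K : ℝ) ^ ((1 + 2 * θ) * (1 - 2 * σ)) * (K : ℝ) ^ (2 * θ) * K =
      (K : ℝ) ^ ((2 + 4 * θ) * (1 - σ)) := by
    rw [← Real.rpow_add hK0, ← Real.rpow_add_one hK0.ne']
    congr 1; ring
  have hII' : (ZII.card : ℝ) ≤ cII * T * (K : ℝ) ^ ((2 + 4 * θ) * (1 - σ)) * ℓ ^ (2 * c + 3) := by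
    have h1 : (1 + Real.log ((K : ℝ) + T + 2)) ^ (2 * c) ≤ (5 * ℓ) ^ (2 * c) :=
      pow_le_pow_left₀ hlogKT0 hlogKT _
    have h2 : (1 + Real.log K) ^ 3 ≤ (3 * ℓ) ^ 3 := pow_le_pow_left₀ hlogK30 hlogK3 3
    have h3 : ((K : ℝ) + K) * T * (1 + Real.log K) ^ 3 ≤ (2 * K) * T * (3 * ℓ) ^ 3 := by
      rw [← two_mul]
      exact mul_le_mul_of_nonneg_left h2 (mul_nonneg (by positivity) hT0)
    have h0 : 0 ≤ C₂ * (A₁ * (1 + c / ((1 - θ) / 2)) ^ c) ^ 2 := mul_nonneg hC₂ (sq_nonneg _)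
    calc (ZII.card : ℝ) ≤ C₂ * (A₁ * (1 + c / ((1 - θ) / 2)) ^ c) ^ 2 * x ^ (1 - 2 * σ) *
          ((K : ℝ) + T + 2) ^ (2 * θ) * (1 + Real.log ((K : ℝ) + T + 2)) ^ (2 * c) *
          (((K : ℝ) + K) * T * (1 + Real.log K) ^ 3) := hIIcount
      _ ≤ C₂ * (A₁ * (1 + c / ((1 - θ) / 2)) ^ c) ^ 2 * (K : ℝ) ^ ((1 + 2 * θ) * (1 - 2 * σ)) *
          (9 * (K : ℝ) ^ (2 * θ)) * (5 * ℓ) ^ (2 * c) * ((2 * K) * T * (3 * ℓ) ^ 3) :=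
          mul_le_mul (mul_le_mul (mul_le_mul (mul_le_mul_of_nonneg_left hx1pow h0) hKTpow hKTpow0
            (mul_nonneg h0 hKa0)) h1 (pow_nonneg hlogKT0 _)
            (mul_nonneg (mul_nonneg h0 hKa0) (mul_nonneg (by norm_num) hK2θ0))) h3
            (mul_nonneg (mul_nonneg (by positivity) hT0) (pow_nonneg hlogK30 3))
            (mul_nonneg (mul_nonneg (mul_nonneg h0 hKa0) (mul_nonneg (by norm_num) hK2θ0))
              (pow_nonneg (mul_nonneg (by norm_num) hℓ0) _))
      _ = cII * T * ((K : ℝ) ^ ((1 + 2 * θ) * (1 - 2 * σ)) * (K : ℝ) ^ (2 * θ) * K) * ℓ ^ (2 * c + 3) := by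
          rw [hcII, mul_pow, mul_pow, pow_add]; ring
      _ = cII * T * (K : ℝ) ^ ((2 + 4 * θ) * (1 - σ)) * ℓ ^ (2 * c + 3) := by rw [hKcomb]
  -- the count
  have hlogT : Real.log (T + 2 * K + 8) ≤ 4 * ℓ := by
    have h8 : (8 : ℝ) ≤ (K : ℝ) ^ 3 := by
      have := pow_le_pow_left₀ (by norm_num : (0 : ℝ) ≤ 2) hK2 3
      norm_num at this
      exact this
    have hK4 : T + 2 * K + 8 ≤ (K : ℝ) ^ 4 := by
      have e4 : (K : ℝ) ^ 4 = K * (K : ℝ) ^ 3 := by ring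
      have h8K := mul_le_mul_of_nonneg_left h8 hK0.le
      rw [e4]; linarith
    calc Real.log (T + 2 * K + 8) ≤ Real.log ((K : ℝ) ^ 4) := Real.log_le_log (by linarith) hK4
      _ = 4 * ℓ := by rw [Real.log_pow, hℓdef]; push_cast; ring
  have hpowI : ℓ ^ 263 * ℓ ≤ E2 * ℓ ^ (2 * c + 268) := by
    rw [← pow_succ, ← hE2]; exact pow_le_two_pow_mul_pow hℓ hℓ0 (by omega)
  have hpowII : ℓ ^ (2 * c + 3) * ℓ ≤ E2 * ℓ ^ (2 * c + 268) := by
    rw [← pow_succ, ← hE2]; exact pow_le_two_pow_mul_pow hℓ hℓ0 (by omega)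
  obtain ⟨P, hP⟩ : ∃ P : ℝ, P = T * (K : ℝ) ^ ((2 + 4 * θ) * (1 - σ)) := ⟨_, rfl⟩
  have hP0 : 0 ≤ P := by rw [hP]; exact mul_nonneg hT0 hKe0
  have h8A : 0 ≤ 8 * A := by linarith
  calc (zeroCount σ T K : ℝ) ≤ 2 * A * Real.log (T + 2 * K + 8) * Z.card := hcount
    _ ≤ 2 * A * (4 * ℓ) * Z.card :=
        mul_le_mul_of_nonneg_right (mul_le_mul_of_nonneg_left hlogT (by linarith)) (Nat.cast_nonneg _)
    _ = 8 * A * ℓ * (ZI.card + ZII.card : ℝ) := by rw [hsplit]; push_cast; ring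
    _ ≤ 8 * A * ℓ * (cI * T * (K : ℝ) ^ ((2 + 4 * θ) * (1 - σ)) * ℓ ^ 263 +
          cII * T * (K : ℝ) ^ ((2 + 4 * θ) * (1 - σ)) * ℓ ^ (2 * c + 3)) :=
        mul_le_mul_of_nonneg_left (add_le_add hI' hII') (mul_nonneg h8A hℓ0)
    _ = 8 * A * P * (cI * (ℓ ^ 263 * ℓ) + cII * (ℓ ^ (2 * c + 3) * ℓ)) := by rw [hP]; ring
    _ ≤ 8 * A * P * (cI * (E2 * ℓ ^ (2 * c + 268)) + cII * (E2 * ℓ ^ (2 * c + 268))) :=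
        mul_le_mul_of_nonneg_left (add_le_add (mul_le_mul_of_nonneg_left hpowI hcI0)
          (mul_le_mul_of_nonneg_left hpowII hcII0)) (mul_nonneg h8A hP0)
    _ = 8 * A * E2 * (cI + cII) * T * (K : ℝ) ^ ((2 + 4 * θ) * (1 - σ)) * ℓ ^ (2 * c + 268) := by
        rw [hP]; ring

/-! ### Ricci's theorem from the Weyl-type bound -/

/-- **`ricci_zeroDensity` from a Weyl-type bound on the critical line**: if
`|D_m(1/2 + iτ)| ≤ A₁ (m + |τ| + 2)^{1/3} log^c (m + |τ| + 2)` for all `m ≥ 1` and real `τ`, then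
`N(σ; T, K) ≪ T K^{(10/3)(1-σ)} (log K)^B` uniformly for `σ ≥ 1/2`, `T = T(K) ≥ 2`, `T/K → 0`, i.e. the
named fact `GaussianHecke.ricci_zeroDensity` holds (with `B = 2c + 268`).
[cite: HuangLiuRudnick2020, Thm. 3 (Ricci 1976)] [cite: Montgomery1971, Ch. 12] -/
theorem ricci_zeroDensity_of_pointwise {A₁ : ℝ} {c : ℕ} (hA₁ : 1 ≤ A₁)
    (hPW : ∀ m : ℕ, m ≠ 0 → ∀ τ : ℝ, ‖heckeL m (1 / 2 + τ * I)‖ ≤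
        A₁ * ((m : ℝ) + |τ| + 2) ^ (1 / 3 : ℝ) * Real.log ((m : ℝ) + |τ| + 2) ^ c) :
    ricci_zeroDensity := by
  obtain ⟨C, hC⟩ := zeroCount_le_of_pointwise hA₁ (by norm_num) (by norm_num) hPW
  obtain ⟨E2, hE2⟩ : ∃ E : ℝ, (2 : ℝ) ^ (2 * c + 268) = E := ⟨_, rfl⟩
  refine ⟨((2 * c + 268 : ℕ) : ℝ), by positivity, fun T hT2 hT ↦ ?_⟩
  obtain ⟨C', hC'⟩ := ricci_bound_of_le_seven_tenths T hT2 hT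
  obtain ⟨K₀, hK₀⟩ := exists_forall_le_of_tendsto_div hT
  refine ricci_reduction (B := ((2 * c + 268 : ℕ) : ℝ)) (by positivity) T hT2 K₀
    (C₀ := max C 0 + max C' 0 * E2) ?_
  intro K hKK₀ hK σ hσ hσ1
  have hTK := hK₀ K hKK₀
  have hK2 : (2 : ℝ) ≤ K := by exact_mod_cast hK
  obtain ⟨hℓ2, hℓ⟩ := one_le_two_mul_log hK
  have hℓ0 : 0 ≤ Real.log K := by linarith
  have hTK0 : 0 ≤ T K := by linarith [hT2 K]
  have hE20 : 0 ≤ E2 := by rw [← hE2]; exact pow_nonneg (by norm_num) _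
  rw [Real.rpow_natCast]
  have hKp0 : 0 ≤ (K : ℝ) ^ ((10 / 3 : ℝ) * (1 - σ)) := Real.rpow_nonneg (by linarith) _
  have hrhs : ∀ {a b : ℝ}, 0 ≤ a → 0 ≤ b → a ≤ max C 0 → b ≤ max C' 0 * E2 →
      a * T K * (K : ℝ) ^ ((10 / 3 : ℝ) * (1 - σ)) * Real.log K ^ (2 * c + 268) +
        b * T K * (K : ℝ) ^ ((10 / 3 : ℝ) * (1 - σ)) * Real.log K ^ (2 * c + 268) ≤
      (max C 0 + max C' 0 * E2) * T K * (K : ℝ) ^ ((10 / 3 : ℝ) * (1 - σ)) * Real.log K ^ (2 * c + 268) := by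
    intro a b ha hb haC hbC
    have hQ : 0 ≤ T K * (K : ℝ) ^ ((10 / 3 : ℝ) * (1 - σ)) * Real.log K ^ (2 * c + 268) :=
      mul_nonneg (mul_nonneg hTK0 hKp0) (pow_nonneg hℓ0 _)
    have key := mul_le_mul_of_nonneg_right (add_le_add haC hbC) hQ
    linarith [key]
  rcases le_total σ (7 / 10) with h7 | h7
  · have h1 := hC' K hK σ hσ h7
    have hlogpow : Real.log K ≤ E2 * Real.log K ^ (2 * c + 268) := by
      have := pow_le_two_pow_mul_pow hℓ hℓ0 (show 1 ≤ 2 * c + 268 by omega)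
      rwa [pow_one, hE2] at this
    calc (zeroCount σ (T K) K : ℝ) ≤ C' * T K * (K : ℝ) ^ ((10 / 3 : ℝ) * (1 - σ)) * Real.log K := h1
      _ ≤ max C' 0 * T K * (K : ℝ) ^ ((10 / 3 : ℝ) * (1 - σ)) * Real.log K :=
          mul_le_mul_of_nonneg_right (mul_le_mul_of_nonneg_right
            (mul_le_mul_of_nonneg_right (le_max_left _ _) hTK0) hKp0) hℓ0
      _ ≤ max C' 0 * T K * (K : ℝ) ^ ((10 / 3 : ℝ) * (1 - σ)) * (E2 * Real.log K ^ (2 * c + 268)) :=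
          mul_le_mul_of_nonneg_left hlogpow (mul_nonneg (mul_nonneg (le_max_right _ _) hTK0) hKp0)
      _ = 0 * T K * (K : ℝ) ^ ((10 / 3 : ℝ) * (1 - σ)) * Real.log K ^ (2 * c + 268) +
            (max C' 0 * E2) * T K * (K : ℝ) ^ ((10 / 3 : ℝ) * (1 - σ)) * Real.log K ^ (2 * c + 268) := by
          ring
      _ ≤ _ := hrhs le_rfl (mul_nonneg (le_max_right _ _) hE20) (le_max_right _ _) le_rfl
  · have h1 := hC K (T K) σ hK (hT2 K) hTK h7 hσ1
    have he : (2 + 4 * (1 / 3 : ℝ)) * (1 - σ) = (10 / 3 : ℝ) * (1 - σ) := by ring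
    rw [he] at h1
    calc (zeroCount σ (T K) K : ℝ) ≤ C * T K * (K : ℝ) ^ ((10 / 3 : ℝ) * (1 - σ)) * Real.log K ^ (2 * c + 268) := h1
      _ ≤ max C 0 * T K * (K : ℝ) ^ ((10 / 3 : ℝ) * (1 - σ)) * Real.log K ^ (2 * c + 268) :=
          mul_le_mul_of_nonneg_right (mul_le_mul_of_nonneg_right
            (mul_le_mul_of_nonneg_right (le_max_left _ _) hTK0) hKp0) (pow_nonneg hℓ0 _)
      _ = max C 0 * T K * (K : ℝ) ^ ((10 / 3 : ℝ) * (1 - σ)) * Real.log K ^ (2 * c + 268) +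
            0 * T K * (K : ℝ) ^ ((10 / 3 : ℝ) * (1 - σ)) * Real.log K ^ (2 * c + 268) := by ring
      _ ≤ _ := hrhs (le_max_right _ _) le_rfl le_rfl (mul_nonneg (le_max_right _ _) hE20)

end GaussianHecke

end Literature.NumberTheory.LFunctions
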